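import Summits.QuantumFields.BalabanUV.Beta.D1BFx.TwoPointLegPieces
import Summits.QuantumFields.BalabanUV.Beta.D1BFx.GhostLegFree
import Summits.QuantumFields.BalabanUV.Beta.D1BFx.FineHessianGhostGrades
import Summits.QuantumFields.BalabanUV.Beta.D1BFx.FrozenLegProfile

/-!
# `BalabanUV.Beta.D1BFx.GhostTwoPointLegPieces` — road «BF-x» for binder row D1, END-ii row «L-GBUB-ii» PART 1 (the ghost twin of PART II (I2)
# `TwoPointLegPieces`): the TWO REGRADED GHOST LEG PIECES `P₀ = g(y − x)` (frozen) and `P₁ = n²·Ggh x y − g(y − x)` (regraded ghost leg minus frozen)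
# as scalar two-point legs — per list of static ∕ moving end steps: the FAR soft row, the FLAT window row, the free part (piece 0 only)

HONEST DEPENDENCY (page 1, mandatory): continuum YM on T⁴ ⇐ BetaPertH ∧ nine spine estimates (0/9 proved); BetaPertH ⇐ (D1) ∧ (D4) ∧
CAP+tail; G-an2-4 gates asym, D1 and NE2/3/4.  HONEST FRAMING (cell contract, verbatim): «discharging `BetaPertH` makes Bałaban's UV
stability UNCONDITIONAL — a real constructive-QFT result; it is NOT the continuum limit and NOT the Clay problem.»  THIS MODULE DISCHARGES
NOTHING of the wall: [folklore] composition BY NAME of PART II (I2) `TwoPointLegPieces` (`abs_itL_itR_le_of_first_step`), (G) `TwoPointLegRows.abs_itL_itR_slice_le`,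
(I1) `TwoPointFrozen`, (C2) `ScaleLegTermBound` (`abs_iterD_far_le`, `abs_iterD_flat_le`, `iterD_const_eq_free_add_flat`), the HYPOTHESIS-FREE ghost rows of
`GhostLegFree` (`ghost_h0`, `ghost_h1`: the regraded ghost leg `n²·Ggh` is `gFree + O(n⁻²)`-graded with `cSplit(4,a)`), `GhostLeg.Ggh_symm`, and the packers
`FineHessianGhostGrades.ghLeg` ∕ `FineHessianLegGrades.frozenLeg`.  The far rows d0∕d1 of `n²·Ggh` and of the profile `g`, and the window rows h0∕h1 of `g`,
are HYPOTHESES in the END's shape; no `def`, no `Prop` minted, nothing cited, 0 sorry.  0 wall binders; NOT a row, NOT (K), NOT D1, NOT `BetaPertH`,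
NOT continuum, NOT Clay.

ABSOLUTE RULE (cell charter, verbatim): «No internally-minted statement may enter as a cited fact. Every hypothesis is either kernel-proved in
this package or a verbatim quotation of a PUBLISHED theorem with page reference. The manuscript(s) under audit are NOT citable for their own
disputed steps — they are the thing under adjudication; programme-internal (2001/route/tribunal) claims are never citable.»

WHY (owner d1-p2-g11 RULING ρ-g11-9 ∕ `END-ii-SPEC.md` v1 §2–§3: reading (ii) — the END's ghost rest words at the REGRADED frozen profile
`gGh = n⁻²·gfrz`, so that `ghLeg n a gGh = n⁻² • ![frozenLeg gfrz, n²•Ggh − frozenLeg gfrz]`; §3(c) «L-GBUB-ii: gan24-leaf-05 FIRST REFUSAL, pattern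
`GluonBubbleTails.hLoc_bub_of_prop12`»).  After the regrade the two ghost pieces are LITERALLY the gluon road's `legPiece 0` ∕ `legPiece 1` diagonal
entries with `K^∞_{κκ}` replaced by `n²·Ggh` (fibre `Unit`, no off-diagonal piece): this file is PART II (I2) for them.
* §1 [folklore] the regraded pieces' entries (`ghPiece_zero_apply`∕`_entry`, `ghPiece_one_apply`∕`_entry`), evenness of `G₀`, the transposes (`Ggh_symm`, `g` even).
* §2 [folklore] ENTRY TOOLS for `n²·Ggh`: `abs_nGgh_self_le` (`Z = |G₀ 0| + cSplit`), the flat kernel `n²·Ggh − G₀` and its one-step bounds `cSplit∕n³`.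
* §3 [folklore] THE PACKAGES: **`far_frozen`∕`split_frozen`** (piece 0), **`far_one`∕`flat_one`** (piece 1).
Unit `b2b-balaban-gan24-formalise-leaf-05` (gen 44), G-an2-4 swarm leaf seat on road «BF-x» at the OWNER's grant (ρ-g11-9 (3)(c)); `LEAVES-BFx.md` row «L-GBUB-ii» PART 1.
-/

noncomputable section
namespace Summit.QuantumFields.BalabanUV.Beta.D1BFx.GhostTwoPointLegPieces

open Literature.MathematicalPhysics.QuantumFieldTheory.Balaban1983to89 Literature.MathematicalPhysics.QuantumFieldTheory.Balaban1983to89.Beta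
open B12Sec2to5 (l1)
open ExpKernelCalculus (Site MKer)
open DyadicShell (Pt supNorm)
open BubbleTransfer (unitVec)
open GhostTable (gFree)
open PoissonInterior (G₀)
open TwoPowerLegs (free)
open GradedBubbles (Fam iterD IsStep)
open ScaleLegTermBound (abs_iterD_far_le abs_iterD_flat_le iterD_const_eq_free_add_flat)
open TwoPointEnds (SKer itL itR itL_sub itR_sub)
open TwoPointLegRows (abs_itL_itR_slice_le)
open TwoPointFrozen (itL_itR_transl steps_append_neg)
open TwoPointLegPieces (abs_itL_itR_le_of_first_step)
open PointColumnSplit (cSplit cSplit_nonneg)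
open Summit.QuantumFields.BalabanUV.Beta.D1BFx.GhostLeg (Ggh Ggh_symm)
open Summit.QuantumFields.BalabanUV.Beta.D1BFx.GhostLegFree (ghost_h0 ghost_h1 gFree_eq_G₀)
open Summit.QuantumFields.BalabanUV.Beta.D1BFx.FineHessianLegGrades (frozenLeg frozenLeg_apply)
open Summit.QuantumFields.BalabanUV.Beta.D1BFx.FineHessianGhostGrades (ghLeg ghLeg_zero ghLeg_one)

variable {n : ℕ} [NeZero n] {a : ℝ} {g : Pt → ℝ}

/-! ## §1 The entries of the two regraded pieces; evenness; transposes -/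

/-- [folklore] **REGRADED PIECE 0 IS THE FROZEN PROFILE**, entrywise (the fibre is `Unit`): `(n² • ghLeg n a (n⁻²·g) 0) x y u v = g (y − x)`. -/
theorem ghPiece_zero_apply (x y : Pt) (u v : Unit) :
    ((n : ℝ) ^ 2 • ghLeg n a (fun v => ((n : ℝ) ^ 2)⁻¹ * g v) 0) x y u v = g (y - x) := by
  have hn : ((n : ℝ) ^ 2) ≠ 0 := pow_ne_zero 2 (Nat.cast_ne_zero.mpr (NeZero.ne n))
  rw [ghLeg_zero]
  simp only [Pi.smul_apply, frozenLeg_apply, if_true, smul_eq_mul]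
  exact mul_inv_cancel_left₀ hn _

/-- [folklore] **REGRADED PIECE 1 IS THE REGRADED GHOST LEG MINUS THE FROZEN PROFILE**, entrywise: `(n² • ghLeg n a (n⁻²·g) 1) x y u v = n²·Ggh x y − g (y − x)`. -/
theorem ghPiece_one_apply (x y : Pt) (u v : Unit) :
    ((n : ℝ) ^ 2 • ghLeg n a (fun v => ((n : ℝ) ^ 2)⁻¹ * g v) 1) x y u v = (n : ℝ) ^ 2 * Ggh n a x y () () - g (y - x) := by
  have hn : ((n : ℝ) ^ 2) ≠ 0 := pow_ne_zero 2 (Nat.cast_ne_zero.mpr (NeZero.ne n))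
  obtain ⟨⟩ := u; obtain ⟨⟩ := v
  rw [ghLeg_one]
  simp only [Pi.smul_apply, Pi.sub_apply, frozenLeg_apply, if_true, smul_eq_mul, mul_sub, mul_inv_cancel_left₀ hn]

/-- [folklore] Piece 0 as a scalar two-point kernel: `fun x y ↦ g (y − x)`. -/
theorem ghPiece_zero_entry :
    (fun x y : Pt => ((n : ℝ) ^ 2 • ghLeg n a (fun v => ((n : ℝ) ^ 2)⁻¹ * g v) 0) x y () ()) = fun x y => g (y - x) := by
  funext x y; exact ghPiece_zero_apply x y () ()

/-- [folklore] Piece 1 as a scalar two-point kernel: `fun x y ↦ n²·Ggh x y − g (y − x)`. -/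
theorem ghPiece_one_entry :
    (fun x y : Pt => ((n : ℝ) ^ 2 • ghLeg n a (fun v => ((n : ℝ) ^ 2)⁻¹ * g v) 1) x y () ()) =
      fun x y => (n : ℝ) ^ 2 * Ggh n a x y () () - g (y - x) := by
  funext x y; exact ghPiece_one_apply x y () ()

omit [NeZero n] in
/-- [folklore] `G₀` is even. -/
theorem G₀_even (v : Pt) : G₀ (-v) = G₀ v := by
  rw [FrozenLegProfile.neg_eq_sgnVec, FrozenLegProfile.G₀_sgnVec]

omit [NeZero n] in
/-- [folklore] `gFree = G₀`, as functions. -/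
theorem gFree_eq : (gFree : Pt → ℝ) = G₀ := funext fun v => gFree_eq_G₀ v

/-- [folklore] The regraded ghost leg is symmetric (`Ggh_symm`). -/
theorem nGgh_symm (ha : 0 < a) (x y : Pt) : (n : ℝ) ^ 2 * Ggh n a y x () () = (n : ℝ) ^ 2 * Ggh n a x y () () := by
  rw [Ggh_symm n a ha y x () ()]

/-- [folklore] **TRANSPOSE, PIECE 0** (`g` even). -/
theorem piece_zero_transpose (hg : ∀ w, g (-w) = g w) (x y : Pt) : g (x - y) = g (y - x) := by
  rw [← hg (x - y), neg_sub]

/-- [folklore] **TRANSPOSE, PIECE 1** (`Ggh` symmetric, `g` even). -/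
theorem piece_one_transpose (ha : 0 < a) (hg : ∀ w, g (-w) = g w) (x y : Pt) :
    (n : ℝ) ^ 2 * Ggh n a y x () () - g (x - y) = (n : ℝ) ^ 2 * Ggh n a x y () () - g (y - x) := by
  rw [nGgh_symm ha, piece_zero_transpose hg]

/-! ## §2 Entry tools for the regraded ghost leg `n²·Ggh` (hypothesis-free: `GhostLegFree`) -/

section Entry

variable (ha : 0 < a)
include ha

/-- [folklore] **THE FLAT KERNEL `n²·Ggh x y − G₀ (y − x)`: value `≤ cSplit∕n²`** (`ghost_h0` at base point `y`). -/
theorem abs_ghFlat_le (x y : Pt) : |(n : ℝ) ^ 2 * Ggh n a x y () () - G₀ (y - x)| ≤ cSplit 4 a / (n : ℝ) ^ 2 := by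
  have h := ghost_h0 n ha y (x - y)
  rwa [show y + (x - y) = x by abel, gFree_eq_G₀, show x - y = -(y - x) by abel, G₀_even] at h

/-- [folklore] **THE VALUE ON THE DIAGONAL OF SITES**: `|n²·Ggh x x| ≤ |G₀ 0| + cSplit(4,a)`. -/
theorem abs_nGgh_self_le (x : Pt) : |(n : ℝ) ^ 2 * Ggh n a x x () ()| ≤ |G₀ (0 : Pt)| + cSplit 4 a := by
  have hn1 : (1 : ℝ) ≤ (n : ℝ) ^ 2 := one_le_pow₀ (by exact_mod_cast NeZero.one_le)
  have h1 := abs_ghFlat_le (n := n) ha x x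
  rw [sub_self] at h1
  have h2 : |(n : ℝ) ^ 2 * Ggh n a x x () () - G₀ 0| ≤ cSplit 4 a := h1.trans (div_le_self (cSplit_nonneg 4 ha) hn1)
  have := abs_sub_abs_le_abs_sub ((n : ℝ) ^ 2 * Ggh n a x x () ()) (G₀ (0 : Pt))
  linarith

/-- [folklore] One MOVING step of the flat kernel: `≤ cSplit∕n³` (both orientations; `ghost_h1` at base point `x` via `Ggh_symm`). -/
theorem abs_ghFlat_dR_le (x y : Pt) {e : Pt} (he : IsStep e) :
    |((n : ℝ) ^ 2 * Ggh n a x (y + e) () () - G₀ (y + e - x)) - ((n : ℝ) ^ 2 * Ggh n a x y () () - G₀ (y - x))| ≤ cSplit 4 a / (n : ℝ) ^ 3 := by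
  obtain ⟨ρ, rfl | rfl⟩ := he
  · have h1 := ghost_h1 n ha x (y - x) ρ
    rw [show x + (y - x + unitVec ρ) = y + unitVec ρ by abel, show x + (y - x) = y by abel, gFree_eq_G₀, gFree_eq_G₀,
      show y - x + unitVec ρ = y + unitVec ρ - x by abel] at h1
    rwa [← nGgh_symm ha x (y + unitVec ρ), ← nGgh_symm ha x y]
  · have h1 := ghost_h1 n ha x (y + -unitVec ρ - x) ρ
    rw [show x + (y + -unitVec ρ - x + unitVec ρ) = y by abel, show x + (y + -unitVec ρ - x) = y + -unitVec ρ by abel, gFree_eq_G₀, gFree_eq_G₀,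
      show y + -unitVec ρ - x + unitVec ρ = y - x by abel, abs_sub_comm] at h1
    rwa [← nGgh_symm ha x (y + -unitVec ρ), ← nGgh_symm ha x y]

/-- [folklore] One STATIC step of the flat kernel: `≤ cSplit∕n³` (both orientations; `ghost_h1` at base point `y`, `G₀` even). -/
theorem abs_ghFlat_dL_le (x y : Pt) {e : Pt} (he : IsStep e) :
    |((n : ℝ) ^ 2 * Ggh n a (x + e) y () () - G₀ (y - (x + e))) - ((n : ℝ) ^ 2 * Ggh n a x y () () - G₀ (y - x))| ≤ cSplit 4 a / (n : ℝ) ^ 3 := by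
  obtain ⟨ρ, rfl | rfl⟩ := he
  · have h1 := ghost_h1 n ha y (x - y) ρ
    rw [show y + (x - y + unitVec ρ) = x + unitVec ρ by abel, show y + (x - y) = x by abel, gFree_eq_G₀, gFree_eq_G₀,
      show x - y + unitVec ρ = -(y - (x + unitVec ρ)) by abel, G₀_even, show x - y = -(y - x) by abel, G₀_even] at h1
    exact h1
  · have h1 := ghost_h1 n ha y (x + -unitVec ρ - y) ρ
    rw [show y + (x + -unitVec ρ - y + unitVec ρ) = x by abel, show y + (x + -unitVec ρ - y) = x + -unitVec ρ by abel, gFree_eq_G₀, gFree_eq_G₀,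
      show x + -unitVec ρ - y + unitVec ρ = -(y - x) by abel, G₀_even, show x + -unitVec ρ - y = -(y - (x + -unitVec ρ)) by abel, G₀_even,
      abs_sub_comm] at h1
    exact h1

end Entry

/-! ## §3 The packages: far soft row, flat row, free part -/

section Packages

variable (hn : 1 ≤ n) {δ A₀ A₁ D₀ D₁ : ℝ} (ha : 0 < a)
include hn

omit [NeZero n] in
/-- [folklore] **PIECE 0 (frozen), FAR**: the profile's rows d0∕d1∕h0 ⇒
`|itL sL (itR sR (g(y − x))) x₀ (x₀+u)| ≤ (5A₀ + 8A₁ + |gFree 0| + D₀)·8e^δ(1+8e^δ)^k·E(u)/(‖u‖∞+1)^{2+min k 1}`. -/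
theorem far_frozen (hδ : 0 ≤ δ) (hA₀ : 0 ≤ A₀) (hA₁ : 0 ≤ A₁)
    (d0 : ∀ v : Pt, v ≠ 0 → |g v| ≤ A₀ * Real.exp (-(δ / n) * supNorm v) / (supNorm v : ℝ) ^ 2)
    (d1 : ∀ v : Pt, v ≠ 0 → ∀ ρ : Fin 4, |g (v + unitVec ρ) - g v| ≤ A₁ * Real.exp (-(δ / n) * supNorm v) / (supNorm v : ℝ) ^ 3)
    (h0 : ∀ v : Pt, |g v - gFree v| ≤ D₀ / (n : ℝ) ^ 2)
    {sL sR : List Pt} (hsL : ∀ e ∈ sL, IsStep e) (hsR : ∀ e ∈ sR, IsStep e) (x₀ u : Pt) :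
    |itL sL (itR sR (fun x y : Pt => g (y - x))) x₀ (x₀ + u)| ≤
      (5 * A₀ + 8 * A₁ + (|gFree 0| + D₀)) * (8 * Real.exp δ) * (1 + 2 ^ 3 * Real.exp δ) ^ (sL.length + sR.length) *
        Real.exp (-(δ / n) * supNorm u) / ((supNorm u : ℝ) + 1) ^ (2 + min (sL.length + sR.length) 1) := by
  rw [itL_itR_transl]
  obtain ⟨hst, hlen⟩ := steps_append_neg hsL hsR
  have h := abs_iterD_far_le hn hδ hA₀ hA₁ d0 d1 h0 hst u
  rw [hlen, show sR.length + sL.length = sL.length + sR.length by omega] at h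
  exact h

omit [NeZero n] in
/-- [folklore] **PIECE 0, WINDOW SPLIT**: free part + flat part, `itL sL (itR sR (g(y − x))) x₀ (x₀+u) = F u + Φ u` with
`F = iterD (sR ++ sL.map neg) gFree` and `|Φ u| ≤ (D₀+D₁)2^k/n^{2+min k 1}`. -/
theorem split_frozen (hD₁ : 0 ≤ D₁) (h0 : ∀ v : Pt, |g v - gFree v| ≤ D₀ / (n : ℝ) ^ 2)
    (h1 : ∀ (v : Pt) (ρ : Fin 4), |(g (v + unitVec ρ) - gFree (v + unitVec ρ)) - (g v - gFree v)| ≤ D₁ / (n : ℝ) ^ 3)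
    {sL sR : List Pt} (hsL : ∀ e ∈ sL, IsStep e) (hsR : ∀ e ∈ sR, IsStep e) (x₀ u : Pt) :
    itL sL (itR sR (fun x y : Pt => g (y - x))) x₀ (x₀ + u) =
      iterD (sR ++ sL.map Neg.neg) free.g 0 0 u + iterD (sR ++ sL.map Neg.neg) (fun (_ : ℕ) (_ : ℕ) => fun v => g v - gFree v) 0 0 u ∧
    |iterD (sR ++ sL.map Neg.neg) (fun (_ : ℕ) (_ : ℕ) => fun v => g v - gFree v) 0 0 u| ≤
      (D₀ + D₁) * 2 ^ (sL.length + sR.length) / (n : ℝ) ^ (2 + min (sL.length + sR.length) 1) := by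
  rw [itL_itR_transl]
  obtain ⟨hst, hlen⟩ := steps_append_neg hsL hsR
  refine ⟨iterD_const_eq_free_add_flat g _ 0 0 u, ?_⟩
  have h := abs_iterD_flat_le hn hD₁ h0 h1 hst u
  rw [hlen, show sR.length + sL.length = sL.length + sR.length by omega] at h
  exact h

include ha in
/-- [folklore] **PIECE 1 (regraded ghost leg minus frozen), FAR**: the far rows d0∕d1 of `n²·Ggh` (in `GhostLegFree`'s shape `n²·Ggh (b+v) b`, every base
point) + the profile's rows ⇒ the sum of the two far bounds, `Z = |G₀ 0| + cSplit(4,a)` for the leg's self value. -/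
theorem far_one (hδ : 0 ≤ δ) (hA₀ : 0 ≤ A₀) (hA₁ : 0 ≤ A₁)
    (e0 : ∀ (b v : Pt), v ≠ 0 → |(n : ℝ) ^ 2 * Ggh n a (b + v) b () ()| ≤ A₀ * Real.exp (-(δ / n) * supNorm v) / (supNorm v : ℝ) ^ 2)
    (e1 : ∀ (b v : Pt), v ≠ 0 → ∀ ρ : Fin 4, |(n : ℝ) ^ 2 * Ggh n a (b + (v + unitVec ρ)) b () () - (n : ℝ) ^ 2 * Ggh n a (b + v) b () ()| ≤
      A₁ * Real.exp (-(δ / n) * supNorm v) / (supNorm v : ℝ) ^ 3)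
    (d0 : ∀ v : Pt, v ≠ 0 → |g v| ≤ A₀ * Real.exp (-(δ / n) * supNorm v) / (supNorm v : ℝ) ^ 2)
    (d1 : ∀ v : Pt, v ≠ 0 → ∀ ρ : Fin 4, |g (v + unitVec ρ) - g v| ≤ A₁ * Real.exp (-(δ / n) * supNorm v) / (supNorm v : ℝ) ^ 3)
    (h0 : ∀ v : Pt, |g v - gFree v| ≤ D₀ / (n : ℝ) ^ 2)
    {sL sR : List Pt} (hsL : ∀ e ∈ sL, IsStep e) (hsR : ∀ e ∈ sR, IsStep e) (x₀ u : Pt) :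
    |itL sL (itR sR (fun x y : Pt => (n : ℝ) ^ 2 * Ggh n a x y () () - g (y - x))) x₀ (x₀ + u)| ≤
      ((5 * A₀ + 8 * A₁ + (|G₀ (0 : Pt)| + cSplit 4 a)) * (8 * Real.exp δ)
        + (5 * A₀ + 8 * A₁ + (|gFree 0| + D₀)) * (8 * Real.exp δ)) * (1 + 2 ^ 3 * Real.exp δ) ^ (sL.length + sR.length) *
        Real.exp (-(δ / n) * supNorm u) / ((supNorm u : ℝ) + 1) ^ (2 + min (sL.length + sR.length) 1) := by
  have esub : (fun x y : Pt => (n : ℝ) ^ 2 * Ggh n a x y () () - g (y - x)) =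
      fun x y => (fun x y : Pt => (n : ℝ) ^ 2 * Ggh n a x y () ()) x y - (fun x y : Pt => g (y - x)) x y := rfl
  rw [esub, itR_sub, itL_sub]
  have hK := abs_itL_itR_slice_le hn hδ hA₀ hA₁ (K := fun x y => (n : ℝ) ^ 2 * Ggh n a x y () ()) (fun x => abs_nGgh_self_le ha x)
    (fun x v hv => by rw [nGgh_symm (n := n) ha (x + v) x]; exact e0 x v hv)
    (fun x v hv ρ => by rw [nGgh_symm (n := n) ha (x + v + unitVec ρ) x, nGgh_symm (n := n) ha (x + v) x, add_assoc]; exact e1 x v hv ρ)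
    (fun y v hv => e0 y v hv)
    (fun y v hv ρ => by rw [add_assoc]; exact e1 y v hv ρ) hsL hsR x₀ u
  have hF := far_frozen (g := g) hn hδ hA₀ hA₁ d0 d1 h0 hsL hsR x₀ u
  refine (abs_sub _ _).trans ?_
  rw [add_mul, add_mul, add_div]
  exact add_le_add hK hF

include ha in
/-- [folklore] **PIECE 1, FLAT**: `(n²·Ggh − G₀) − ((g − gFree)∘(y − x))` (using `G₀ = gFree`) ⇒
`|itL sL (itR sR P₁) x₀ (x₀+u)| ≤ ((cSplit + cSplit) + (D₀ + D₁))·2^k/n^{2+min k 1}`. -/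
theorem flat_one (hD₁ : 0 ≤ D₁) (h0 : ∀ v : Pt, |g v - gFree v| ≤ D₀ / (n : ℝ) ^ 2)
    (h1 : ∀ (v : Pt) (ρ : Fin 4), |(g (v + unitVec ρ) - gFree (v + unitVec ρ)) - (g v - gFree v)| ≤ D₁ / (n : ℝ) ^ 3)
    {sL sR : List Pt} (hsL : ∀ e ∈ sL, IsStep e) (hsR : ∀ e ∈ sR, IsStep e) (x₀ u : Pt) :
    |itL sL (itR sR (fun x y : Pt => (n : ℝ) ^ 2 * Ggh n a x y () () - g (y - x))) x₀ (x₀ + u)| ≤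
      ((cSplit 4 a + cSplit 4 a) + (D₀ + D₁)) * 2 ^ (sL.length + sR.length) / (n : ℝ) ^ (2 + min (sL.length + sR.length) 1) := by
  have hG : ∀ v : Pt, G₀ v = gFree v := fun v => (gFree_eq_G₀ v).symm
  -- split the kernel: `(K − G₀∘d) − ((g − gFree)∘d)`
  have esub : (fun x y : Pt => (n : ℝ) ^ 2 * Ggh n a x y () () - g (y - x)) =
      fun x y => (fun x y : Pt => (n : ℝ) ^ 2 * Ggh n a x y () () - G₀ (y - x)) x y - (fun x y : Pt => (fun v => g v - gFree v) (y - x)) x y := by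
    funext x y; simp only [hG]; ring
  rw [esub, itR_sub, itL_sub]
  have hn0 : (0 : ℝ) < n := by exact_mod_cast hn
  have hC : 0 ≤ cSplit 4 a := cSplit_nonneg 4 ha
  -- part 1: the flat kernel
  have hK : |itL sL (itR sR (fun x y : Pt => (n : ℝ) ^ 2 * Ggh n a x y () () - G₀ (y - x))) x₀ (x₀ + u)| ≤
      (cSplit 4 a + cSplit 4 a) * 2 ^ (sL.length + sR.length) / (n : ℝ) ^ (2 + min (sL.length + sR.length) 1) := by
    rcases Nat.eq_zero_or_pos (sL.length + sR.length) with hk | hk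
    · have e1 : sL = [] := List.eq_nil_of_length_eq_zero (by omega)
      have e2 : sR = [] := List.eq_nil_of_length_eq_zero (by omega)
      subst e1; subst e2
      simp only [itL, itR, List.length_nil, add_zero, pow_zero, mul_one, Nat.min_eq_left (Nat.zero_le 1)]
      have h := abs_ghFlat_le (n := n) ha x₀ (x₀ + u)
      exact h.trans (div_le_div_of_nonneg_right (by linarith) (by positivity))
    · have hmin : min (sL.length + sR.length) 1 = 1 := by omega
      rw [hmin]
      have h := abs_itL_itR_le_of_first_step (K := fun x y : Pt => (n : ℝ) ^ 2 * Ggh n a x y () () - G₀ (y - x))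
        (M₁ := cSplit 4 a / (n : ℝ) ^ 3) (by positivity)
        (fun x y e he => abs_ghFlat_dR_le ha x y he) (fun x y e he => abs_ghFlat_dL_le ha x y he) hsL hsR hk x₀ (x₀ + u)
      refine h.trans ?_
      rw [mul_div_assoc']
      exact div_le_div_of_nonneg_right (by nlinarith [pow_pos (two_pos : (0:ℝ) < 2) (sL.length + sR.length)]) (by positivity)
  -- part 2: the profile's flat part, a one-variable leg
  have hF : |itL sL (itR sR (fun x y : Pt => (fun v => g v - gFree v) (y - x))) x₀ (x₀ + u)| ≤
      (D₀ + D₁) * 2 ^ (sL.length + sR.length) / (n : ℝ) ^ (2 + min (sL.length + sR.length) 1) := by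
    rw [itL_itR_transl sL sR (fun v => g v - gFree v) x₀ u]
    obtain ⟨hst, hlen⟩ := steps_append_neg hsL hsR
    have h := abs_iterD_flat_le hn hD₁ h0 h1 hst u
    rw [hlen, show sR.length + sL.length = sL.length + sR.length by omega] at h
    exact h
  refine (abs_sub _ _).trans ?_
  rw [add_mul, add_div]
  exact add_le_add hK hF

end Packages

end Summit.QuantumFields.BalabanUV.Beta.D1BFx.GhostTwoPointLegPieces
end
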